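import Mathlib
import HarnessLib
import HarnessLib.Audit
import Summits.ValiantsHypothesis.ValiantsHypothesis.Theorems.LacunarySymmetroidMatrixDescartesMiddleBinomial
import Summits.ValiantsHypothesis.ValiantsHypothesis.Theorems.LacunarySymmetroidMatrixDescartesZeroChangeConcavityBudgetFloor

/-!
# ValiantsHypothesis / LacunarySymmetroid — crux `MatrixDescartes` (stmt-ValiantsHypothesis-18050, V1), LINE (A) «product_plus_one»:
# DIPS ARE EARLY — the dip inequality of the pure `(+,−,−)` core, kernel form

Eighth part of the concavity budget (✓ `…ConcavityBudget{,Floor,General,Dip,Windows,PureT5}`).  The floor `OneChangeFloorK3` is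
equivalent to a linear budget on the DIPS `𝔇 = {t > 0 : Φ′(t) = 0, Φ(t) ≠ 0, Φ(t)Φ″(t) ≥ 0}` of the row product `Φ = ∏_j g_j`
(✓ `oneChangeFloorK3_of_dipBudget`).  Here the concavity identity ✓ `concavity_identity`
(`t²ΦΦ″ = Φ²·(a(a−c)M − Σ_j φ_j²)`, `φ_j = t g_j′/g_j`) is read AT A DIP:

* `sum_sq_logDeriv_le_of_dip` — ANY company: at a dip, `Σ_j φ_j(t)² ≤ a(a−c)·M(t)` (so `M < 0` strictly unless every row is critical);
* ★ `pureT5_dip_early` — PURE `(+,−,−)` company (`m ≥ 1`, `0 < a < c`): at a dip `t`, with `U(t) = {j : g_j(t) > 0}` the rows whose root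
  lies to the RIGHT of `t` («unswitched»), `a·m < (c − a)·#U(t)`.  Mechanism: `Σ_S φ_j = Σ_U (−φ_j) =: P` (criticality), `φ_j > a` on the
  switched rows, `a(a−c)M ≤ a(c−a)·Σ_U |a_{j1}|t^a/g_j ≤ (c−a)·P`, and Cauchy–Schwarz on both sides: `m·P² ≤ #S·#U·Σφ² ≤ #S·#U·(c−a)·P`.
  So dips only occur BEFORE the roots of more than `a·m/(c−a)` rows: the last `⌊a·m/(c−a)⌋` windows of a pure `(+,−,−)` company are
  dip-free (for `c ≤ 2a` there is no dip at all — inside the closed tame sector), `pureT5_dip_early_nat` is the `ℕ` form;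
* ★ `pureT5_card_crit_Ioo_le_one_of_late` — window form: a root-free window `(u, v) ⊂ (0, ∞)` on which `(c − a)·#U ≤ a·m` carries AT MOST
  ONE critical point (via ✓ `card_crit_Ioo_le_two_mul_card_notGood_add_one`).

HONEST FRAMING: a LOCALISATION of the dips of the open core (pure `(+,−,−)` rows, bottom coupling, ratio `> 4`), not a count; def-free,
no named facts, no sorry, standard axioms; closes NO stub by name; `OneChangeFloorK3`, `EulerBoundK3`, `ClassRowK3Linear`, `PPOPolyLaw`,
`MatrixDescartes` (stmt-ValiantsHypothesis-18050) stay OPEN; `VP ≠ VNP` is NOT proved and nothing here bears on it.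

[folklore] Elementary real analysis (Cauchy–Schwarz) and counting; no citation needed.
-/

set_option linter.dupNamespace false

namespace Summit.ValiantsHypothesis.ValiantsHypothesis.Theorems.LacunarySymmetroidMatrixDescartes

namespace ZeroChange

open Polynomial Finset

/-! ## The dip inequality (any company) -/

/-- **Dip inequality** (any company of trinomial rows, from ✓ `concavity_identity`): at a positive critical point `t` of
`Φ = ∏_j g_j` off the roots with `Φ(t)Φ″(t) ≥ 0` (a dip: local minimum of `|Φ|` or degenerate critical point),
`Σ_j (t g_j′(t)/g_j(t))² ≤ a(a−c)·M(t)`. -/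
theorem sum_sq_logDeriv_le_of_dip (m a c : ℕ) (co : Fin m → ℝ × ℝ × ℝ) {t : ℝ} (ht : 0 < t)
    (hΦ : (∏ j, row a c (co j).1 (co j).2.1 (co j).2.2).eval t ≠ 0)
    (hcrit : (derivative (∏ j, row a c (co j).1 (co j).2.1 (co j).2.2)).eval t = 0)
    (hdip : 0 ≤ (∏ j, row a c (co j).1 (co j).2.1 (co j).2.2).eval t *
      (derivative (derivative (∏ j, row a c (co j).1 (co j).2.1 (co j).2.2))).eval t) :
    ∑ j, (t * (derivative (row a c (co j).1 (co j).2.1 (co j).2.2)).eval t /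
        (row a c (co j).1 (co j).2.1 (co j).2.2).eval t) ^ 2 ≤
      (a : ℝ) * ((a : ℝ) - c) * middleSum a c co t := by
  have hid := concavity_identity m a c co ht hΦ hcrit
  have h0 : 0 ≤ t ^ 2 * ((∏ j, row a c (co j).1 (co j).2.1 (co j).2.2).eval t *
      (derivative (derivative (∏ j, row a c (co j).1 (co j).2.1 (co j).2.2))).eval t) :=
    mul_nonneg (sq_nonneg t) hdip
  rw [hid] at h0
  have hΦ2 : 0 < ((∏ j, row a c (co j).1 (co j).2.1 (co j).2.2).eval t) ^ 2 := by positivity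
  by_contra hlt
  nlinarith [mul_pos hΦ2 (sub_pos.2 (not_le.1 hlt))]

/-! ## Pure `(+,−,−)` companies: dips are early -/

/-- ★ **DIPS ARE EARLY** (pure `(+,−,−)` company, `m ≥ 1`, `0 < a < c`): at a dip `t` (positive critical point off the roots with
`Φ(t)Φ″(t) ≥ 0`), the rows still positive at `t` (root to the right of `t`) number MORE than `a·m/(c − a)`:
`a·m < (c − a)·#{j : g_j(t) > 0}`. -/
theorem pureT5_dip_early (m a c : ℕ) (hm : 0 < m) (ha : 0 < a) (hac : a < c) (co : Fin m → ℝ × ℝ × ℝ)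
    (hT5 : ∀ j, 0 < (co j).1 ∧ (co j).2.1 ≤ 0 ∧ (co j).2.2 ≤ 0 ∧ ((co j).2.1 < 0 ∨ (co j).2.2 < 0))
    {t : ℝ} (ht : 0 < t)
    (hΦ : (∏ j, row a c (co j).1 (co j).2.1 (co j).2.2).eval t ≠ 0)
    (hcrit : (derivative (∏ j, row a c (co j).1 (co j).2.1 (co j).2.2)).eval t = 0)
    (hdip : 0 ≤ (∏ j, row a c (co j).1 (co j).2.1 (co j).2.2).eval t *
      (derivative (derivative (∏ j, row a c (co j).1 (co j).2.1 (co j).2.2))).eval t) :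
    (a : ℝ) * m < ((c : ℝ) - a) *
      ((univ.filter (fun j => 0 < (row a c (co j).1 (co j).2.1 (co j).2.2).eval t)).card : ℝ) := by
  have ha' : (0 : ℝ) < a := by exact_mod_cast ha
  have hc' : (0 : ℝ) < c := by exact_mod_cast (ha.trans hac)
  have hca : (0 : ℝ) < (c : ℝ) - a := by
    have : (a : ℝ) < c := by exact_mod_cast hac
    linarith
  have hta : 0 < t ^ a := pow_pos ht a
  have htc : 0 < t ^ c := pow_pos ht c
  have hgt : ∀ j, (row a c (co j).1 (co j).2.1 (co j).2.2).eval t ≠ 0 := by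
    intro j h0
    apply hΦ
    rw [eval_prod]
    exact prod_eq_zero (mem_univ j) h0
  -- the logarithmic derivatives `φ_j = t g_j′(t)/g_j(t) = (a a_{j1} t^a + c a_{j2} t^c)/g_j(t)`
  set φ : Fin m → ℝ := fun j => t * (derivative (row a c (co j).1 (co j).2.1 (co j).2.2)).eval t /
    (row a c (co j).1 (co j).2.1 (co j).2.2).eval t with hφ
  have hφj : ∀ j, φ j = ((a : ℝ) * (co j).2.1 * t ^ a + (c : ℝ) * (co j).2.2 * t ^ c) /
      (row a c (co j).1 (co j).2.1 (co j).2.2).eval t := by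
    intro j
    simp only [hφ]
    rw [mul_eval_derivative_row]
  -- (F1) criticality: `Σ_j φ_j = 0`
  have hsum0 : ∑ j, φ j = 0 := by
    have h := eval_derivative_prod_rows m a c co hgt
    rw [hcrit] at h
    have hS : ∑ j, (derivative (row a c (co j).1 (co j).2.1 (co j).2.2)).eval t /
        (row a c (co j).1 (co j).2.1 (co j).2.2).eval t = 0 := (mul_eq_zero.1 h.symm).resolve_left hΦ
    have e : ∑ j, φ j = t * ∑ j, (derivative (row a c (co j).1 (co j).2.1 (co j).2.2)).eval t /
        (row a c (co j).1 (co j).2.1 (co j).2.2).eval t := by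
      rw [mul_sum]
      refine sum_congr rfl fun j _ => ?_
      simp only [hφ]
      ring
    rw [e, hS, mul_zero]
  -- (F2) the dip inequality
  have hdipineq : ∑ j, φ j ^ 2 ≤ (a : ℝ) * ((a : ℝ) - c) * middleSum a c co t :=
    sum_sq_logDeriv_le_of_dip m a c co ht hΦ hcrit hdip
  -- splittings along `p j := 0 < g_j(t)` (stated before naming the two halves `U`, `S`)
  have hcard0 := card_filter_add_card_filter_not (s := (univ : Finset (Fin m)))
    (fun j => 0 < (row a c (co j).1 (co j).2.1 (co j).2.2).eval t)
  rw [card_univ, Fintype.card_fin] at hcard0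
  have hsplitφ : ∑ j ∈ univ.filter (fun j => 0 < (row a c (co j).1 (co j).2.1 (co j).2.2).eval t), φ j +
      ∑ j ∈ univ.filter (fun j => ¬ 0 < (row a c (co j).1 (co j).2.1 (co j).2.2).eval t), φ j = ∑ j, φ j :=
    sum_filter_add_sum_filter_not _ _ _
  have hsplit2 : ∑ j ∈ univ.filter (fun j => 0 < (row a c (co j).1 (co j).2.1 (co j).2.2).eval t), φ j ^ 2 +
      ∑ j ∈ univ.filter (fun j => ¬ 0 < (row a c (co j).1 (co j).2.1 (co j).2.2).eval t), φ j ^ 2 = ∑ j, φ j ^ 2 :=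
    sum_filter_add_sum_filter_not _ _ _
  have hMsplit : ∑ j ∈ univ.filter (fun j => 0 < (row a c (co j).1 (co j).2.1 (co j).2.2).eval t),
        (co j).2.1 * t ^ a / (row a c (co j).1 (co j).2.1 (co j).2.2).eval t +
      ∑ j ∈ univ.filter (fun j => ¬ 0 < (row a c (co j).1 (co j).2.1 (co j).2.2).eval t),
        (co j).2.1 * t ^ a / (row a c (co j).1 (co j).2.1 (co j).2.2).eval t = middleSum a c co t := by
    rw [middleSum]
    exact sum_filter_add_sum_filter_not _ _ _
  -- unswitched rows `U` (`g_j(t) > 0`) and switched rows `S` (`g_j(t) < 0`)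
  set U := univ.filter (fun j => 0 < (row a c (co j).1 (co j).2.1 (co j).2.2).eval t) with hU
  set S := univ.filter (fun j => ¬ 0 < (row a c (co j).1 (co j).2.1 (co j).2.2).eval t) with hS
  have hmemU : ∀ j, j ∈ U ↔ 0 < (row a c (co j).1 (co j).2.1 (co j).2.2).eval t := by
    intro j
    rw [hU, mem_filter]
    simp
  have hmemS : ∀ j, j ∈ S ↔ (row a c (co j).1 (co j).2.1 (co j).2.2).eval t < 0 := by
    intro j
    rw [hS, mem_filter]
    simp only [mem_univ, true_and, not_lt]
    exact ⟨fun h => lt_of_le_of_ne h (hgt j), fun h => h.le⟩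
  have hcardSU : (S.card : ℝ) + U.card = m := by
    have h' : ((U.card + S.card : ℕ) : ℝ) = m := by exact_mod_cast hcard0
    push_cast at h'
    linarith
  -- (F5) switched rows: `φ_j > a`
  have hSgt : ∀ j ∈ S, (a : ℝ) < φ j := by
    intro j hj
    have hg : (row a c (co j).1 (co j).2.1 (co j).2.2).eval t < 0 := (hmemS j).1 hj
    obtain ⟨hp, -, hs, -⟩ := hT5 j
    have hγ : (co j).2.2 * t ^ c ≤ 0 := mul_nonpos_iff.2 (Or.inr ⟨hs, htc.le⟩)
    rw [hφj j, lt_div_iff_of_neg hg, eval_row]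
    nlinarith [mul_nonpos_iff.2 (Or.inl ⟨hca.le, hγ⟩), mul_pos ha' hp]
  -- (F4) unswitched rows: `−φ_j ≥ a·|a_{j1}|t^a/g_j ≥ 0`, and `−φ_j > 0`
  have hUge : ∀ j ∈ U, (a : ℝ) * (-(co j).2.1 * t ^ a / (row a c (co j).1 (co j).2.1 (co j).2.2).eval t) ≤ -φ j := by
    intro j hj
    have hg : 0 < (row a c (co j).1 (co j).2.1 (co j).2.2).eval t := (hmemU j).1 hj
    obtain ⟨-, -, hs, -⟩ := hT5 j
    have hγ : (co j).2.2 * t ^ c ≤ 0 := mul_nonpos_iff.2 (Or.inr ⟨hs, htc.le⟩)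
    rw [hφj j, ← mul_div_assoc, ← neg_div, div_le_div_iff_of_pos_right hg]
    nlinarith [mul_nonpos_iff.2 (Or.inl ⟨hc'.le, hγ⟩)]
  have hUpos : ∀ j ∈ U, 0 < -φ j := by
    intro j hj
    have hg : 0 < (row a c (co j).1 (co j).2.1 (co j).2.2).eval t := (hmemU j).1 hj
    obtain ⟨-, hq, hs, hqs⟩ := hT5 j
    rw [hφj j, ← neg_div]
    refine div_pos ?_ hg
    rcases hqs with hq' | hs'
    · nlinarith [mul_nonpos_iff.2 (Or.inl ⟨hc'.le, mul_nonpos_iff.2 (Or.inr ⟨hs, htc.le⟩)⟩),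
        mul_neg_of_pos_of_neg ha' (mul_neg_of_neg_of_pos hq' hta)]
    · nlinarith [mul_nonpos_iff.2 (Or.inl ⟨ha'.le, mul_nonpos_iff.2 (Or.inr ⟨hq, hta.le⟩)⟩),
        mul_neg_of_pos_of_neg hc' (mul_neg_of_neg_of_pos hs' htc)]
  -- the common value `P = Σ_U (−φ_j) = Σ_S φ_j`
  set P := ∑ j ∈ U, -φ j with hP
  have hSsum : ∑ j ∈ S, φ j = P := by
    rw [hP, sum_neg_distrib]
    linarith [hsum0]
  have hUsum : ∑ j ∈ U, φ j = -P := by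
    rw [hP, sum_neg_distrib, neg_neg]
  -- (F3) `a(a−c)·M ≤ (c−a)·P`
  have hXU : (a : ℝ) * ((a : ℝ) - c) * middleSum a c co t ≤ ((c : ℝ) - a) * P := by
    have hSnn : 0 ≤ ∑ j ∈ S, (co j).2.1 * t ^ a / (row a c (co j).1 (co j).2.1 (co j).2.2).eval t := by
      refine sum_nonneg fun j hj => ?_
      have hg : (row a c (co j).1 (co j).2.1 (co j).2.2).eval t < 0 := (hmemS j).1 hj
      obtain ⟨-, hq, -, -⟩ := hT5 j
      exact div_nonneg_of_nonpos (mul_nonpos_iff.2 (Or.inr ⟨hq, hta.le⟩)) hg.le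
    have haXU : (a : ℝ) * ∑ j ∈ U, (-(co j).2.1 * t ^ a / (row a c (co j).1 (co j).2.1 (co j).2.2).eval t) ≤ P := by
      rw [hP, mul_sum]
      exact sum_le_sum hUge
    have hneg : ∑ j ∈ U, (-(co j).2.1 * t ^ a / (row a c (co j).1 (co j).2.1 (co j).2.2).eval t) =
        -∑ j ∈ U, (co j).2.1 * t ^ a / (row a c (co j).1 (co j).2.1 (co j).2.2).eval t := by
      rw [← sum_neg_distrib]
      refine sum_congr rfl fun j _ => ?_
      ring
    rw [hneg] at haXU
    have hM : -middleSum a c co t ≤ -∑ j ∈ U, (co j).2.1 * t ^ a / (row a c (co j).1 (co j).2.1 (co j).2.2).eval t := by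
      linarith
    have h1 : (a : ℝ) * ((a : ℝ) - c) * middleSum a c co t = (a : ℝ) * ((c : ℝ) - a) * (-middleSum a c co t) := by ring
    rw [h1]
    calc (a : ℝ) * ((c : ℝ) - a) * (-middleSum a c co t)
        ≤ (a : ℝ) * ((c : ℝ) - a) * (-∑ j ∈ U, (co j).2.1 * t ^ a / (row a c (co j).1 (co j).2.1 (co j).2.2).eval t) :=
          mul_le_mul_of_nonneg_left hM (mul_pos ha' hca).le
      _ = ((c : ℝ) - a) * ((a : ℝ) * (-∑ j ∈ U, (co j).2.1 * t ^ a / (row a c (co j).1 (co j).2.1 (co j).2.2).eval t)) := by ring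
      _ ≤ ((c : ℝ) - a) * P := mul_le_mul_of_nonneg_left haXU hca.le
  -- (★) `Σ φ² ≤ (c − a)·P`
  have hstar : ∑ j, φ j ^ 2 ≤ ((c : ℝ) - a) * P := hdipineq.trans hXU
  -- `P > 0`: some row exists and no `φ_j` vanishes
  have hPpos : 0 < P := by
    have j₀ : Fin m := ⟨0, hm⟩
    have hφne : φ j₀ ≠ 0 := by
      by_cases h0 : 0 < (row a c (co j₀).1 (co j₀).2.1 (co j₀).2.2).eval t
      · have := hUpos j₀ ((hmemU j₀).2 h0)
        intro h; rw [h] at this; simp at this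
      · have := hSgt j₀ ((hmemS j₀).2 (lt_of_le_of_ne (not_lt.1 h0) (hgt j₀)))
        intro h; rw [h] at this; exact absurd this (not_lt.2 ha'.le)
    have hpos2 : 0 < ∑ j, φ j ^ 2 := by
      calc (0 : ℝ) < φ j₀ ^ 2 := by positivity
        _ ≤ ∑ j, φ j ^ 2 := single_le_sum (f := fun j => φ j ^ 2) (fun j _ => sq_nonneg (φ j)) (mem_univ j₀)
    by_contra hP0
    have : ((c : ℝ) - a) * P ≤ 0 := mul_nonpos_iff.2 (Or.inl ⟨hca.le, not_lt.1 hP0⟩)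
    linarith
  -- `S` is nonempty, hence `a·#S < P`
  have hSne : S.Nonempty := by
    by_contra hSe
    rw [not_nonempty_iff_eq_empty] at hSe
    rw [hSe, sum_empty] at hSsum
    linarith
  have haS : (a : ℝ) * S.card < P := by
    have h := sum_lt_sum_of_nonempty hSne hSgt
    rw [sum_const, nsmul_eq_mul, hSsum] at h
    linarith
  -- Cauchy–Schwarz on both sides: `m·P² ≤ #S·#U·Σφ²`
  have hCSS : P ^ 2 ≤ S.card * ∑ j ∈ S, φ j ^ 2 := by
    rw [← hSsum]
    exact sq_sum_le_card_mul_sum_sq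
  have hCSU : P ^ 2 ≤ U.card * ∑ j ∈ U, φ j ^ 2 := by
    have h : (∑ j ∈ U, φ j) ^ 2 ≤ U.card * ∑ j ∈ U, φ j ^ 2 := sq_sum_le_card_mul_sum_sq
    rw [hUsum, neg_sq] at h
    exact h
  have hScard : (0 : ℝ) < S.card := by exact_mod_cast hSne.card_pos
  have hUcard : (0 : ℝ) ≤ U.card := by exact_mod_cast Nat.zero_le _
  have hmP2 : (m : ℝ) * P ^ 2 ≤ S.card * U.card * (((c : ℝ) - a) * P) := by
    have h1 : (m : ℝ) * P ^ 2 = S.card * P ^ 2 + U.card * P ^ 2 := by rw [← hcardSU]; ring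
    have h2 : (S.card : ℝ) * P ^ 2 ≤ S.card * (U.card * ∑ j ∈ U, φ j ^ 2) := mul_le_mul_of_nonneg_left hCSU hScard.le
    have h3 : (U.card : ℝ) * P ^ 2 ≤ U.card * (S.card * ∑ j ∈ S, φ j ^ 2) := mul_le_mul_of_nonneg_left hCSS hUcard
    have h4 : (S.card : ℝ) * U.card * ∑ j, φ j ^ 2 ≤ S.card * U.card * (((c : ℝ) - a) * P) :=
      mul_le_mul_of_nonneg_left hstar (mul_nonneg hScard.le hUcard)
    rw [← hsplit2] at h4
    linarith [h1, h2, h3, h4]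
  -- conclude: `m·P ≤ #S·#U·(c−a)` and `a·#S < P`
  have hmP : (m : ℝ) * P ≤ S.card * U.card * ((c : ℝ) - a) := by
    have h : (m : ℝ) * P * P ≤ S.card * U.card * ((c : ℝ) - a) * P := by
      calc (m : ℝ) * P * P = m * P ^ 2 := by ring
        _ ≤ S.card * U.card * (((c : ℝ) - a) * P) := hmP2
        _ = S.card * U.card * ((c : ℝ) - a) * P := by ring
    exact le_of_mul_le_mul_right h hPpos
  have hm' : (0 : ℝ) < m := by exact_mod_cast hm
  have key : (S.card : ℝ) * ((a : ℝ) * m) < S.card * (((c : ℝ) - a) * U.card) := by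
    linarith [mul_lt_mul_of_pos_right haS hm', hmP]
  exact lt_of_mul_lt_mul_left key hScard.le

/-- `ℕ` form of ★: at a dip of a pure `(+,−,−)` company, `a·m < (c − a)·#{j : g_j(t) > 0}`. -/
theorem pureT5_dip_early_nat (m a c : ℕ) (hm : 0 < m) (ha : 0 < a) (hac : a < c) (co : Fin m → ℝ × ℝ × ℝ)
    (hT5 : ∀ j, 0 < (co j).1 ∧ (co j).2.1 ≤ 0 ∧ (co j).2.2 ≤ 0 ∧ ((co j).2.1 < 0 ∨ (co j).2.2 < 0))
    {t : ℝ} (ht : 0 < t)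
    (hΦ : (∏ j, row a c (co j).1 (co j).2.1 (co j).2.2).eval t ≠ 0)
    (hcrit : (derivative (∏ j, row a c (co j).1 (co j).2.1 (co j).2.2)).eval t = 0)
    (hdip : 0 ≤ (∏ j, row a c (co j).1 (co j).2.1 (co j).2.2).eval t *
      (derivative (derivative (∏ j, row a c (co j).1 (co j).2.1 (co j).2.2))).eval t) :
    a * m < (c - a) * (univ.filter (fun j => 0 < (row a c (co j).1 (co j).2.1 (co j).2.2).eval t)).card := by
  have h := pureT5_dip_early m a c hm ha hac co hT5 ht hΦ hcrit hdip
  rw [← Nat.cast_sub hac.le] at h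
  exact_mod_cast h

/-- **No dip at ratio `c ≤ 2a`**: a dip of a pure `(+,−,−)` company (`m ≥ 1`) forces `2a < c` (`a·m < (c−a)·#U ≤ (c−a)·m`) — the
dips of the open core live outside the range `c ≤ 2a` (inside the closed tame sector `c ≤ 4a` this is not new as a COUNT, but it is
a statement about every single dip). -/
theorem pureT5_two_mul_lt_of_dip (m a c : ℕ) (hm : 0 < m) (ha : 0 < a) (hac : a < c) (co : Fin m → ℝ × ℝ × ℝ)
    (hT5 : ∀ j, 0 < (co j).1 ∧ (co j).2.1 ≤ 0 ∧ (co j).2.2 ≤ 0 ∧ ((co j).2.1 < 0 ∨ (co j).2.2 < 0))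
    {t : ℝ} (ht : 0 < t)
    (hΦ : (∏ j, row a c (co j).1 (co j).2.1 (co j).2.2).eval t ≠ 0)
    (hcrit : (derivative (∏ j, row a c (co j).1 (co j).2.1 (co j).2.2)).eval t = 0)
    (hdip : 0 ≤ (∏ j, row a c (co j).1 (co j).2.1 (co j).2.2).eval t *
      (derivative (derivative (∏ j, row a c (co j).1 (co j).2.1 (co j).2.2))).eval t) :
    2 * a < c := by
  have h := pureT5_dip_early_nat m a c hm ha hac co hT5 ht hΦ hcrit hdip
  have hU : (univ.filter (fun j => 0 < (row a c (co j).1 (co j).2.1 (co j).2.2).eval t)).card ≤ m := by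
    calc (univ.filter (fun j => 0 < (row a c (co j).1 (co j).2.1 (co j).2.2).eval t)).card
        ≤ (univ : Finset (Fin m)).card := card_filter_le _ _
      _ = m := by rw [card_univ, Fintype.card_fin]
  have h2 : a * m < (c - a) * m := lt_of_lt_of_le h (Nat.mul_le_mul_left _ hU)
  have h3 : a < c - a := Nat.lt_of_mul_lt_mul_right h2
  omega

/-! ## Window form: late windows carry at most one critical point -/

/-- ★ **LATE WINDOWS ARE SIMPLE** (pure `(+,−,−)` company, `m ≥ 1`, `0 < a < c`): on a root-free window `(u, v)` on which
at most `a·m/(c−a)` rows are still positive (`(c − a)·#{j : g_j(z) > 0} ≤ a·m` for `z ∈ (u,v)`), `Φ` has AT MOST ONE critical point —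
there is no dip there (★ `pureT5_dip_early_nat`), so every critical point is a strict local maximum of `|Φ|`, and two of those would enclose
a non-good one (✓ `card_crit_Ioo_le_two_mul_card_notGood_add_one`). -/
theorem pureT5_card_crit_Ioo_le_one_of_late (m a c : ℕ) (hm : 0 < m) (ha : 0 < a) (hac : a < c) (co : Fin m → ℝ × ℝ × ℝ)
    (hT5 : ∀ j, 0 < (co j).1 ∧ (co j).2.1 ≤ 0 ∧ (co j).2.2 ≤ 0 ∧ ((co j).2.1 < 0 ∨ (co j).2.2 < 0))
    {u v : ℝ}
    (hnoroot : ∀ z, u < z → z < v → (∏ j, row a c (co j).1 (co j).2.1 (co j).2.2).eval z ≠ 0)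
    (hlate : ∀ z, u < z → z < v →
      (c - a) * (univ.filter (fun j => 0 < (row a c (co j).1 (co j).2.1 (co j).2.2).eval z)).card ≤ a * m) :
    (((derivative (∏ j, row a c (co j).1 (co j).2.1 (co j).2.2)).roots.toFinset.filter (fun t => 0 < t)).filter
        (fun t => u < t ∧ t < v)).card ≤ 1 := by
  have hbound := card_crit_Ioo_le_two_mul_card_notGood_add_one (∏ j, row a c (co j).1 (co j).2.1 (co j).2.2) hnoroot
  have hN : (((derivative (∏ j, row a c (co j).1 (co j).2.1 (co j).2.2)).roots.toFinset.filter (fun t => 0 < t)).filter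
      (fun t => (u < t ∧ t < v) ∧ ¬ ((∏ j, row a c (co j).1 (co j).2.1 (co j).2.2).eval t *
        (derivative (derivative (∏ j, row a c (co j).1 (co j).2.1 (co j).2.2))).eval t < 0))).card = 0 := by
    rw [card_eq_zero, filter_eq_empty_iff]
    rintro z hz ⟨⟨huz, hzv⟩, hnot⟩
    rw [mem_filter, Multiset.mem_toFinset, mem_roots', IsRoot.def] at hz
    obtain ⟨⟨-, hcrit⟩, hz0⟩ := hz
    have h := pureT5_dip_early_nat m a c hm ha hac co hT5 hz0 (hnoroot z huz hzv) hcrit (not_lt.1 hnot)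
    have h' := hlate z huz hzv
    omega
  rw [hN] at hbound
  omega

end ZeroChange

end Summit.ValiantsHypothesis.ValiantsHypothesis.Theorems.LacunarySymmetroidMatrixDescartes
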